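import Literature.Analysis.Calculus.ExpLocalLieSubalgebra
import HarnessLib

/-!
# `log (exp X · exp Y)` stays in an `Ad`-stable subspace for small `X, Y`

Topic `Analysis/Calculus`; namespace `Literature.Analysis.Calculus`. Let `𝔸` be a real Banach
algebra, `exp` its exponential, `log = localLog` the smooth local inverse of `exp` at `0`
(`SmoothAlongExp`), and `𝔤 ≤ 𝔸` a complemented closed real subspace stable under
`Ad (exp c) : Z ↦ exp(c) Z exp(-c)` for `c ∈ 𝔤` (e.g. the Lie algebra of a linear real group of
`Literature.NumberTheory.Automorphic.RealMatrixGroup`, which need not be all of `Lie(H)`). The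
tree's path theorem `exists_isOpen_forall_localLog_mem` (`ExpLocalLieSubalgebra`: a `C¹` path from
`1` near `1` with logarithmic derivative in `𝔤` has logarithm in `𝔤`) is specialised here to the
product of two one-parameter groups — the form in which the local Lie-subgroup property of
`exp 𝔤` ("`log (e^{X₁} e^{X₂}) ∈ 𝔥`", the key step of Hall 2015, Thm. 5.20, classically read off
the Baker–Campbell–Hausdorff series) is consumed by second-order calculus along `𝔤`, e.g. the
bracket relation `[X, Y] φ = X (Y φ) - Y (X φ)` for functions smooth along `g · exp 𝔤`
(`Literature.NumberTheory.Automorphic.lieDeriv_bracket`):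

* `hasDerivAt_exp_smul_mul_exp_smul` — the path `γ(r) = exp(rX) exp(rY)` has
  `γ' = γ · (Ad(exp(-rY)) X + Y)`;
* `eventually_localLog_exp_mul_exp_mem` — for `(X, Y)` near `(0, 0)` with `X, Y ∈ 𝔤`:
  `log (exp X exp Y) ∈ 𝔤` and `exp (log (exp X exp Y)) = exp X exp Y`;
* `eventually_localLog_exp_smul_mul_exp_smul_mem` — for fixed `X, Y ∈ 𝔤` and `(s, t)` near
  `(0, 0)`: the same for `exp (sX) exp (tY)`.

Everything here is proved; no definitions.

## References

* B. C. Hall, *Lie Groups, Lie Algebras, and Representations*, 2nd ed. (2015), §5.9, Thm. 5.20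
  (and §5.5 for the differential equation of `log (e^X e^{tY})`) [Hall2015].
-/

noncomputable section

open NormedSpace Filter Set Metric
open scoped Topology

namespace Literature.Analysis.Calculus

variable {𝔸 : Type*} [NormedRing 𝔸] [NormedAlgebra ℝ 𝔸] [CompleteSpace 𝔸]

/-- The path `γ(r) = exp(rX) exp(rY)` satisfies `γ' = γ · (exp(-rY) X exp(rY) + Y)` (its
logarithmic derivative is `Ad(exp(-rY)) X + Y`). [folklore] -/
theorem hasDerivAt_exp_smul_mul_exp_smul (X Y : 𝔸) (r : ℝ) :
    HasDerivAt (fun r : ℝ => exp (r • X) * exp (r • Y))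
      (exp (r • X) * exp (r • Y) * (exp (-(r • Y)) * X * exp (r • Y) + Y)) r := by
  have h := (hasDerivAt_exp_smul_const (𝕂 := ℝ) X r).mul (hasDerivAt_exp_smul_const (𝕂 := ℝ) Y r)
  refine h.congr_deriv ?_
  have c : exp (r • Y) * exp (-(r • Y)) = 1 := exp_mul_exp_neg _
  rw [mul_add]
  congr 1
  · simp only [← mul_assoc]
    rw [mul_assoc (exp (r • X)) (exp (r • Y)) (exp (-(r • Y))), c, mul_one]
  · rw [mul_assoc]

variable {𝔤 : Submodule ℝ 𝔸}

/-- **`log (exp X exp Y) ∈ 𝔤` for small `X, Y ∈ 𝔤`.** Let `𝔤` be a complemented closed subspace of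
a real Banach algebra, stable under `Ad (exp c)` for `c ∈ 𝔤`. Then for all `(X, Y)` close enough
to `(0, 0)` with `X, Y ∈ 𝔤`, `localLog (exp X * exp Y) ∈ 𝔤` and
`exp (localLog (exp X * exp Y)) = exp X * exp Y`: apply the path form of the local Lie-subgroup
property (`exists_isOpen_forall_localLog_mem`) to `γ(r) = exp(rX) exp(rY)`, whose logarithmic
derivative `exp(-rY) X exp(rY) + Y` lies in `𝔤` and which stays near `1` uniformly in `r ∈ [0, 1]`
for `(X, Y)` small. For a Lie subalgebra `𝔥 ≤ 𝔤𝔩(n)` this is the step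
"`log (e^{X₁} e^{X₂}) ∈ 𝔥`" of Hall 2015, Theorem 5.20. [cite: Hall2015, Thm. 5.20] -/
theorem eventually_localLog_exp_mul_exp_mem (h𝔤 : 𝔤.ClosedComplemented)
    (hAd : ∀ c ∈ 𝔤, ∀ Z ∈ 𝔤, exp c * Z * exp (-c) ∈ 𝔤) :
    ∀ᶠ p in 𝓝 (0 : 𝔸 × 𝔸), p.1 ∈ 𝔤 → p.2 ∈ 𝔤 →
      localLog (exp p.1 * exp p.2) ∈ 𝔤 ∧ exp (localLog (exp p.1 * exp p.2)) = exp p.1 * exp p.2 := by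
  obtain ⟨V, hVopen, hV1, hVlog, hVpath⟩ := exists_isOpen_forall_localLog_mem h𝔤 hAd
  have hexpc : Continuous (exp : 𝔸 → 𝔸) := (contDiff_exp (m := 0)).continuous
  -- `exp a * exp b ∈ V` for `‖(a, b)‖ < δ`
  have hm : Tendsto (fun p : 𝔸 × 𝔸 => exp p.1 * exp p.2) (𝓝 0) (𝓝 1) := by
    have hc : Continuous fun p : 𝔸 × 𝔸 => exp p.1 * exp p.2 :=
      (hexpc.comp continuous_fst).mul (hexpc.comp continuous_snd)
    have := hc.continuousAt (x := (0 : 𝔸 × 𝔸))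
    simpa [ContinuousAt] using this
  obtain ⟨δ, hδ, hδV⟩ := Metric.eventually_nhds_iff.mp (hm.eventually (hVopen.mem_nhds hV1))
  refine Metric.eventually_nhds_iff.mpr ⟨δ, hδ, ?_⟩
  rintro ⟨X, Y⟩ hXY hX hY
  simp only at hX hY ⊢
  have hXY' : ‖X‖ < δ ∧ ‖Y‖ < δ := by
    rwa [dist_zero_right, Prod.norm_def, max_lt_iff] at hXY
  -- the path `γ(r) = exp(rX) exp(rY)` from `1` to `exp X exp Y` and its logarithmic derivative
  set γ : ℝ → 𝔸 := fun r => exp (r • X) * exp (r • Y) with hγ_def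
  set ξ : ℝ → 𝔸 := fun r => exp (-(r • Y)) * X * exp (r • Y) + Y with hξ_def
  have hγ0 : γ 0 = 1 := by simp [hγ_def]
  have hγ1 : γ 1 = exp X * exp Y := by simp [hγ_def]
  have hγV : ∀ r ∈ Icc (0 : ℝ) 1, γ r ∈ V := fun r hr => by
    have h := @hδV (r • X, r • Y) (by
      rw [dist_zero_right, Prod.norm_def, max_lt_iff]
      simp only [norm_smul, Real.norm_eq_abs, abs_of_nonneg hr.1]
      exact ⟨lt_of_le_of_lt (mul_le_of_le_one_left (norm_nonneg _) hr.2) hXY'.1,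
        lt_of_le_of_lt (mul_le_of_le_one_left (norm_nonneg _) hr.2) hXY'.2⟩)
    exact h
  have hγd : ∀ r ∈ Icc (0 : ℝ) 1, HasDerivAt γ (γ r * ξ r) r := fun r _ =>
    hasDerivAt_exp_smul_mul_exp_smul X Y r
  have hξ : ∀ r ∈ Icc (0 : ℝ) 1, ξ r ∈ 𝔤 := fun r _ => by
    have h := hAd (-(r • Y)) (𝔤.neg_mem (𝔤.smul_mem r hY)) X hX
    rw [neg_neg] at h
    exact 𝔤.add_mem h hY
  obtain ⟨B, hB⟩ : ∃ B, ∀ r ∈ Icc (0 : ℝ) 1, ‖ξ r‖ ≤ B := by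
    have hc : Continuous ξ :=
      (((hexpc.comp (continuous_id.smul continuous_const).neg).mul continuous_const).mul
        (hexpc.comp (continuous_id.smul continuous_const))).add continuous_const
    exact isCompact_Icc.exists_bound_of_continuousOn hc.continuousOn
  have hmem := hVpath γ ξ B hγ0 hγV hγd hξ hB 1 ⟨zero_le_one, le_rfl⟩
  have hV' : γ 1 ∈ V := hγV 1 ⟨zero_le_one, le_rfl⟩
  rw [hγ1] at hmem hV'
  exact ⟨hmem, hVlog _ hV'⟩

/-- **One-parameter form.** Under the same hypotheses, for fixed `X, Y ∈ 𝔤` and `(s, t)` close to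
`(0, 0)`: `localLog (exp (sX) exp (tY)) ∈ 𝔤` and `exp (localLog (exp (sX) exp (tY))) = exp (sX) exp (tY)`.
This is the form consumed by the bracket relation `[X, Y] φ = X (Y φ) - Y (X φ)` for chart-wise
smooth functions. Hall 2015, §5.9. [cite: Hall2015, Thm. 5.20] -/
theorem eventually_localLog_exp_smul_mul_exp_smul_mem (h𝔤 : 𝔤.ClosedComplemented)
    (hAd : ∀ c ∈ 𝔤, ∀ Z ∈ 𝔤, exp c * Z * exp (-c) ∈ 𝔤) {X Y : 𝔸} (hX : X ∈ 𝔤) (hY : Y ∈ 𝔤) :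
    ∀ᶠ q in 𝓝 (0 : ℝ × ℝ), localLog (exp (q.1 • X) * exp (q.2 • Y)) ∈ 𝔤 ∧
      exp (localLog (exp (q.1 • X) * exp (q.2 • Y))) = exp (q.1 • X) * exp (q.2 • Y) := by
  have hlin : Tendsto (fun q : ℝ × ℝ => ((q.1 • X, q.2 • Y) : 𝔸 × 𝔸)) (𝓝 0) (𝓝 0) := by
    have hc : Continuous fun q : ℝ × ℝ => ((q.1 • X, q.2 • Y) : 𝔸 × 𝔸) :=
      (continuous_fst.smul continuous_const).prodMk (continuous_snd.smul continuous_const)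
    have := hc.continuousAt (x := (0 : ℝ × ℝ))
    simpa [ContinuousAt, Prod.mk_zero_zero] using this
  filter_upwards [hlin.eventually (eventually_localLog_exp_mul_exp_mem h𝔤 hAd)] with q h
  exact h (𝔤.smul_mem _ hX) (𝔤.smul_mem _ hY)

end Literature.Analysis.Calculus
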